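import Summits.CriticalPhenomena.PercolationContinuityZ3.Theorems.PercNearOneGluingNoHeavyLowerTailQ44bGluingAB
import HarnessLib

/-!
# `Q44b` is concave along the pencil of every pair into the sure cluster of `b` (the `z ∈ [b]` case of `ND_a`)

Support file for crux `stmt-CriticalPhenomena-4575` (master-family programme, quadratic four-point row `Q44b` of
`prim-bnk-1` gen 13, OPEN for all `n`), seat `prim-l12-p6` gen 12; memo
`run/shared/lean/prim/prim-l12/FROM-prim-l12-p6-g12-K8-CENSUS.md` §7.

The reductions of the tree (`Q44b.row_nonneg_of_pencilConcave`, gen 7; `Q44b.row_nonneg_of_mixedAt`, gen 8) ask for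
pencil concavity (`Q44b.PencilConcave`) resp. a nonnegative mixed Bernstein coefficient (`Q44b.PencilMixed`) along the
pencil of EVERY pair `s(x,z)` whose end `x` is surely joined to the terminal `a`.  Gen 7 proved the four-point
inequality behind the case "`z` is the terminal `b`" (`Q44bExchange.crossPendant_exchange_sum`, the crossing-to-pendant
exchange) but not the link to the pencil.  This file supplies the link, through the gluing identity
`P_{w[e↦1]}(E) = P_{w[e↦0]}({ω : ω ∪ {e} ∈ E})` and the one-extra-edge reachability lemma:

* `Q44b.pencilConcave_of_sureJoined_b` — if `x` is surely joined to `a` and `z` surely joined to `b` in `w[s(x,z)↦0]`,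
  then `PencilConcave w s(x,z) a b c y`; explicitly `B₂ = B₀₁ = 0` and
  `B₁₀ − B₀ = P(a|bcy)·P(X′) − P(a|b|cy)·P(X) ≥ 0` (the law-level form of the identity `(I_ab)` of the fibre
  programme, gen 11 §2), all probabilities under `w[s(x,z)↦0]`;
* `Q44b.pencilMixed_of_sureJoined_b` — hence `PencilMixed` there.

So in both reductions the pairs running into `b`'s sure cluster are discharged; the residual hypotheses concern pairs
`s(x,z)` with `z` outside the sure clusters of `a` and `b` (the `c`/`y` cases are the four-point inequality
`Q44bExchange.pencilAtC` of gen 7, whose pencil link is analogous and not repeated here).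
Theorems only; no named facts, no sorries, standard axioms.
-/

noncomputable section

namespace Summit.CriticalPhenomena.PercolationContinuityZ3.Theorems

namespace Q44b

open MeasureTheory Set Literature.Probability.LatticeModels Literature.Probability.Percolation
open scoped Classical

variable {n : ℕ}

/-! ### The pencil into `b`'s sure cluster -/

/-- **Gluing step.**  If `x ∈ [a]` and `z ∈ [b]` surely under `w₀`, then raising the weight of `s(x,z)` to one in the
FIRST copy increases the bilinear form: `bil w₀ w₀ ≤ bil (w₀[s(x,z)↦1]) w₀`; the difference is exactly
`P(a|bcy)·P(X′) − P(a|b|cy)·P(X) ≥ 0` (`Q44bExchange.crossPendant_exchange_sum`). [this work] -/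
theorem bil_le_bil_update_one_of_sureJoined_ab (w0 : Sym2 (Fin n) → unitInterval) {a b x z : Fin n}
    (c y : Fin n) (hx : sureJoined w0 a x) (hz : sureJoined w0 b z) :
    bil w0 w0 a b c y ≤ bil (Function.update w0 s(x, z) 1) w0 a b c y := by
  -- gluing identity
  have glue : ∀ E : Set (BondConfig (Fin n)),
      (prodBernoulli (Function.update w0 s(x, z) 1)).real E = (prodBernoulli w0).real {ω | insert s(x, z) ω ∈ E} := by
    intro E
    have hE : DeterminedBy E (↑(Finset.univ : Finset (Sym2 (Fin n))) : Set (Sym2 (Fin n))) :=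
      TargetExploration.determinedBy_univ E
    exact prodBernoulli_real_update_one_eq hE w0 (Finset.mem_univ _)
  -- almost surely `a ~ x` and `b ~ z`
  have hae : ∀ᵐ ω ∂(prodBernoulli w0), (openGraph ω).Reachable a x ∧ (openGraph ω).Reachable b z := by
    filter_upwards [ae_reachable_of_sureJoined w0 a x hx, ae_reachable_of_sureJoined w0 b z hz] with ω h1 h2
    exact ⟨h1, h2⟩
  -- the glued events
  have gAC : (prodBernoulli (Function.update w0 s(x, z) 1)).real (evAC a b c y) =
      (prodBernoulli w0).real (openConn c y) + (prodBernoulli w0).real (evX a b c y) := by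
    rw [glue, ← measureReal_union (disjoint_cy_evX a b c y) MeasurableSet.of_discrete,
      ← union_AC_eq a b c y]
    refine measureReal_congr ?_
    filter_upwards [hae] with ω hω
    exact propext (insert_mem_evAC_iff ω hω.1 hω.2)
  have gAD : (prodBernoulli (Function.update w0 s(x, z) 1)).real (evAD a b c y) =
      (prodBernoulli w0).real (evAD a b c y) + ((prodBernoulli w0).real (evEmp a b c y) +
        (prodBernoulli w0).real
          ((openConn a b)ᶜ ∩ (openConn a c)ᶜ ∩ (openConn a y)ᶜ ∩ openConn c y ∩ (openConn b y)ᶜ)) := by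
    rw [glue, ← measureReal_union (disjoint_Emp_Sab a b c y) MeasurableSet.of_discrete, ← D4_nab_eq,
      ← measureReal_union (disjoint_AD_rest a b c y) MeasurableSet.of_discrete, ← D4_eq]
    refine measureReal_congr ?_
    filter_upwards [hae] with ω hω
    exact propext (insert_mem_evAD_iff ω hω.1 hω.2)
  have gAB : (prodBernoulli (Function.update w0 s(x, z) 1)).real (evAB a b c y) =
      (prodBernoulli w0).real (evAB a b c y) + (prodBernoulli w0).real (evEmp a b c y) := by
    rw [glue, ← measureReal_union (disjoint_AB_Emp a b c y) MeasurableSet.of_discrete, ← D4_ncy_eq]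
    refine measureReal_congr ?_
    filter_upwards [hae] with ω hω
    exact propext (insert_mem_evAB_iff ω hω.1 hω.2)
  have gPend : (prodBernoulli (Function.update w0 s(x, z) 1)).real (evPend a b c y) = 0 := by
    rw [glue, ← measureReal_empty (μ := prodBernoulli w0)]
    refine measureReal_congr ?_
    filter_upwards [hae] with ω hω
    exact propext (iff_of_false (insert_not_mem_evPend ω hω.1 hω.2) (notMem_empty ω))
  -- cells under `w0`
  have dC : (prodBernoulli w0).real (openConn c y) =
      (prodBernoulli w0).real (evAC a b c y) + (prodBernoulli w0).real (evCnA a b c y) := by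
    rw [← measureReal_union (disjoint_AC_CnA a b c y) MeasurableSet.of_discrete, ← cy_eq_AC_union_CnA]
  have dX : (prodBernoulli w0).real (evX a b c y) =
      (prodBernoulli w0).real ((openConn a b)ᶜ ∩ (openConn a y)ᶜ ∩ openConn a c ∩ openConn b y) +
        (prodBernoulli w0).real ((openConn a b)ᶜ ∩ (openConn a c)ᶜ ∩ openConn a y ∩ openConn b c) := by
    rw [← measureReal_union (disjoint_X12 a b c y) MeasurableSet.of_discrete, ← evX_eq]
  have dXp : (prodBernoulli w0).real (evXp a b c y) =
      (prodBernoulli w0).real ((openConn a b)ᶜ ∩ (openConn a y)ᶜ ∩ openConn a c ∩ (openConn b y)ᶜ) +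
        (prodBernoulli w0).real ((openConn a b)ᶜ ∩ (openConn a c)ᶜ ∩ openConn a y ∩ (openConn b c)ᶜ) := by
    rw [← measureReal_union (disjoint_Xp12 a b c y) MeasurableSet.of_discrete, ← evXp_eq]
  have dPend : (prodBernoulli w0).real (evPend a b c y) =
      (prodBernoulli w0).real
        ((openConn a b)ᶜ ∩ (openConn a c)ᶜ ∩ (openConn a y)ᶜ ∩ openConn b y ∩ openConn c y) := by
    rw [evPend_eq]
  -- the exchange inequality `P(a|b|cy)·P(X) ≤ P(a|bcy)·P(X′)`
  have key := Q44bExchange.crossPendant_exchange_sum w0 a b c y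
  unfold bil
  rw [gAC, gAD, gAB, gPend, dC, dX, dXp, dPend]
  linear_combination key

/-- **`ND_a` at the pairs into `b`'s sure cluster.**  If `x` is surely joined to `a` and `z` to `b` in
`w[s(x,z)↦0]`, the row `Q44b` is concave along the pencil of `s(x,z)`: `B₂ = B₀₁ = 0` (the second copy has `a ~ b`
almost surely) and `B₀ ≤ B₁₀` by the gluing step. [this work] -/
theorem pencilConcave_of_sureJoined_b (w : Sym2 (Fin n) → unitInterval) {a b x z : Fin n} (c y : Fin n)
    (hxz : x ≠ z) (hx : sureJoined (Function.update w s(x, z) 0) a x)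
    (hz : sureJoined (Function.update w s(x, z) 0) b z) :
    PencilConcave w s(x, z) a b c y := by
  unfold PencilConcave
  have hab1 : (prodBernoulli (Function.update w s(x, z) 1)).real (openConn a b) = 1 :=
    real_openConn_eq_one_of_sureJoined _ a b (sureJoined_ab_of_pair w hxz hx hz)
  rw [bil_eq_zero_of_conn_ab_right _ _ a b c y hab1, bil_eq_zero_of_conn_ab_right _ _ a b c y hab1,
    add_zero, zero_add]
  have h := bil_le_bil_update_one_of_sureJoined_ab (Function.update w s(x, z) 0) c y hx hz
  rwa [Function.update_idem] at h

/-- Hence the mixed Bernstein coefficient of the pencil is (conditionally) nonnegative there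
(`Q44b.PencilMixed`, the hypothesis shape of `Q44b.row_nonneg_of_mixedAt`). [this work] -/
theorem pencilMixed_of_sureJoined_b (w : Sym2 (Fin n) → unitInterval) {a b x z : Fin n} (c y : Fin n)
    (hxz : x ≠ z) (hx : sureJoined (Function.update w s(x, z) 0) a x)
    (hz : sureJoined (Function.update w s(x, z) 0) b z) :
    PencilMixed w s(x, z) a b c y :=
  pencilMixed_of_pencilConcave w s(x, z) a b c y (pencilConcave_of_sureJoined_b w c y hxz hx hz)

end Q44b

end Summit.CriticalPhenomena.PercolationContinuityZ3.Theorems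

end
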